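import Summits.CriticalPhenomena.PercolationContinuityZ3.Theorems.Transplant.BoxProdZ2ConcParamsKit
import HarnessLib

/-!
# L7.1 — the generic PARAMETER TOOLKIT over a `PlanarSkeletonConc`, part 1: the DRIFTED radius schedule's facts — the product's `gapFn L' Rex`
# with the planar-travel allowance `dG` absorbed into the excess slot, `gapFn L' (Rex + dG)` — and the linear lower bound on `Erad` that makes
# p2-g3's max-inflated cube radius inactive at run pairs

builds on p205010 (kernel theorem, internal audit signed; external expert review pending) — nothing in this file uses p205010.
Status sentence (coordinator 2026-08-20T04:30Z): "θ(p_c) = 0 on ℤ^d, all d ≥ 2 — kernel-verified (Lean 4/Mathlib, standard axioms); internal adversarial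
audit SIGNED 2026-08-20 04:29Z; external expert review pending."
Lane `prim-bschramm-*`, seat `prim-bschramm-stmt` (gen 7); helper file (`--supports stmt-CriticalPhenomena-4575`).
Parameter ledger: `run/shared/lean/prim/bschramm/prim-bschramm-stmt/CONC-PARAMS-GENERIC.md` (§1 row gapc, §5 (D2)(D3)).
The product toolkit `BoxProdZ2ConcParamsKit` (p225251) §3 (kit counts), §4 (`δmin`, accuracy transfer), §5 (`gapFn` and its eleven schedule
lemmas) and §6 (`Kof`/`tOf`/`cellsOf`, level arithmetic) contain no product token and are IMPORTED by the generic layer, not re-typed; its §1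
(fibre representatives ↦ `Φ.types`/`Φ.frame`) needs no twin, and the generic excess radius at the running parameter (twin of its §2) is a
separate file over hp-8 g22's centre-uniform `exists_excess_radius_uniform` (L4.7).

* §2 the DRIFTED schedule `gap := gapFn L' (fun n ↦ Rex n + dG)` (`= 2 L' + 1 + Rex (ρ+1) + dG`, SHEAR-SCOPE §p3 3.0 item 2: `+dG` planar travel per
  depth; no new gap function): `gapFn_drift`, `two_mul_add_add_le_gapFn_drift` ((F)'s `hgap`), `le_gapFn_drift` (`dG ≤ gap ρ`), `sch_gapFn_drift`
  ((C)'s `hsch`: `Rex (E g + 1) + dG + L' ≤ E (g+1)`), `Frad_one_gapFn_drift` ((R)'s `Rt = F 1 - L' = E₀ + L' + 1 + Rex (E₀+1) + dG`),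
  `Erad_succ_gapFn_drift`;
* §3 **`SkelConc.add_mul_le_Erad`** — `(∀ n, m ≤ gap n) → E₀ + k·m ≤ Erad gap gap' E₀ k`; **`cen_bound_le_Erad`** — `c·j + 1 ≤ E k` once `j ≤ k`,
  `c ≤` every gap, `1 ≤ E₀`: with `c := 20 r`, `j := ‖x‖₁ ≤ nQ a x =: k` (p2-g3's `KNCells2AnchorNorm`: `‖tgt e‖₁ ≤ aOf₁ + 2`) this is the
  condition under which the inflated cube radius `max (E (nQ a x)) (20 r ‖x‖₁ + 1)` of L3.3 `Skel.concRadiiS` equals `E (nQ a x)`;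
  `cen_bound_le_Erad_drift` (the same for the schedule of §2: `c ≤ dG` suffices).
[cite: KozmaNitzan2024, §4 Lemma 12 (p. 24); Theorem 6 (pp. 25–31): the order of constants]
-/

noncomputable section

open MeasureTheory
open scoped Classical

namespace Summit.CriticalPhenomena.PercolationContinuityZ3.Theorems

namespace Transplant

namespace SkelConc

open Literature.Probability.Percolation Literature.Probability.LatticeModels SimpleGraph BoxProdZ2

/-! ## §2 The drifted schedule `gapFn L' (Rex + dG)` -/

section Drift

variable (L' dG : ℕ) (Rex : ℕ → ℕ) (E₀ : ℕ)

/-- **The drifted gap**: `gapFn L' (Rex + dG) ρ = 2 L' + 1 + Rex (ρ + 1) + dG`. [this work] -/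
theorem gapFn_drift (ρ : ℕ) : gapFn L' (fun n => Rex n + dG) ρ = 2 * L' + 1 + Rex (ρ + 1) + dG := by
  simp only [gapFn]; omega

/-- (F)'s schedule condition with the drift visible: `2 L' + Rex (ρ + 1) + dG ≤ gap ρ`. [folklore] -/
theorem two_mul_add_add_le_gapFn_drift (ρ : ℕ) : 2 * L' + Rex (ρ + 1) + dG ≤ gapFn L' (fun n => Rex n + dG) ρ := by
  rw [gapFn_drift]; omega

/-- The drift alone fits in the gap: `dG ≤ gap ρ` (planar travel per depth). [folklore] -/
theorem le_gapFn_drift (ρ : ℕ) : dG ≤ gapFn L' (fun n => Rex n + dG) ρ := by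
  rw [gapFn_drift]; omega

/-- Every gap is at least `dG`: the hypothesis shape of `add_mul_le_Erad` below. [folklore] -/
theorem forall_le_gapFn_drift : ∀ n, dG ≤ gapFn L' (fun n => Rex n + dG) n := le_gapFn_drift L' dG Rex

/-- **(C)'s schedule condition with the drift visible**: `Rex (E g + 1) + dG + L' ≤ E (g + 1)` for
`E := Erad (gapFn L' (Rex + dG)) 0 E₀`. [folklore] -/
theorem sch_gapFn_drift :
    ∀ g, Rex (Erad (gapFn L' (fun n => Rex n + dG)) (fun _ => 0) E₀ g + 1) + dG + L' ≤
      Erad (gapFn L' (fun n => Rex n + dG)) (fun _ => 0) E₀ (g + 1) :=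
  sch_gapFn L' (fun n => Rex n + dG) E₀

/-- **(R)'s tube radius with the drift visible**: `F 1 - L' = E₀ + L' + 1 + Rex (E₀ + 1) + dG`. [folklore] -/
theorem Frad_one_gapFn_drift :
    Frad (gapFn L' (fun n => Rex n + dG)) (fun _ => 0) E₀ 1 - L' = E₀ + L' + 1 + Rex (E₀ + 1) + dG := by
  rw [Frad_one_gapFn]; omega

/-- `E g + 2 L' + 1 + Rex (E g + 1) + dG = E (g + 1)` (the level step with the drift visible). [folklore] -/
theorem Erad_succ_gapFn_drift (g : ℕ) :
    Erad (gapFn L' (fun n => Rex n + dG)) (fun _ => 0) E₀ (g + 1) =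
      Erad (gapFn L' (fun n => Rex n + dG)) (fun _ => 0) E₀ g + 2 * L' + 1 +
        Rex (Erad (gapFn L' (fun n => Rex n + dG)) (fun _ => 0) E₀ g + 1) + dG := by
  rw [Erad_succ_gapFn_eq]; omega

end Drift

/-! ## §3 A linear lower bound on the radii (the inflated cube radius is inactive at run pairs) -/

section Linear

variable (gap gap' : ℕ → ℕ) (E₀ : ℕ)

/-- **`E₀ + k · m ≤ E k` when every gap is `≥ m`.** [folklore] -/
theorem add_mul_le_Erad {m : ℕ} (hgap : ∀ n, m ≤ gap n) : ∀ k, E₀ + k * m ≤ Erad gap gap' E₀ k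
  | 0 => by simp [Erad]
  | k + 1 => by
    have ih := add_mul_le_Erad hgap k
    have h1 := hgap (Erad gap gap' E₀ k)
    have h2 : Erad gap gap' E₀ k + gap (Erad gap gap' E₀ k) ≤ Erad gap gap' E₀ (k + 1) := by
      rw [Erad_succ, Frad_succ]; omega
    calc E₀ + (k + 1) * m = E₀ + k * m + m := by ring
      _ ≤ Erad gap gap' E₀ k + gap (Erad gap gap' E₀ k) := by omega
      _ ≤ Erad gap gap' E₀ (k + 1) := h2

/-- **The planar-offset bound of a cell is below the cube radius**: `c · j + 1 ≤ E k` whenever `j ≤ k`, `c ≤` every gap and `1 ≤ E₀` — with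
`c := 20 r` and `j := ‖x‖₁ ≤ nQ a x =: k` this is the condition under which p2-g3's inflated cube radius `max (E (nQ a x)) (20 r ‖x‖₁ + 1)` is
`E (nQ a x)` (SkelCellsConcG's `colQ`). [folklore] -/
theorem cen_bound_le_Erad {c j k : ℕ} (hgap : ∀ n, c ≤ gap n) (hE₀ : 1 ≤ E₀) (hjk : j ≤ k) : c * j + 1 ≤ Erad gap gap' E₀ k := by
  have h := add_mul_le_Erad gap gap' E₀ hgap k
  have hj : c * j ≤ k * c := by rw [mul_comm]; exact Nat.mul_le_mul_right c hjk
  omega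

/-- The same for the drifted schedule of §2: `c ≤ dG`, `1 ≤ E₀`, `j ≤ k` ⟹ `c · j + 1 ≤ E k`. [folklore] -/
theorem cen_bound_le_Erad_drift (L' dG : ℕ) (Rex : ℕ → ℕ) {c j k : ℕ} (hc : c ≤ dG) (hE₀ : 1 ≤ E₀) (hjk : j ≤ k) :
    c * j + 1 ≤ Erad (gapFn L' (fun n => Rex n + dG)) (fun _ => 0) E₀ k :=
  cen_bound_le_Erad _ _ E₀ (fun n => hc.trans (le_gapFn_drift L' dG Rex n)) hE₀ hjk

end Linear

end SkelConc

end Transplant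

end Summit.CriticalPhenomena.PercolationContinuityZ3.Theorems

end
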